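import Mathlib
import HarnessLib
import Summits.Langlands.Statement
import Summits.Langlands.Langlands.Theses.DepthPrimeSplit
import Summits.Langlands.Langlands.Theses.PrimeSwitchSplit
import Summits.Langlands.Langlands.Theorems.TransientLevelSplitLevelFiniteness
import Summits.Langlands.Langlands.Theorems.DepthPrimeSplitClassicalityBoxCapture

/-!
# AvatarConductorSplit — decomp-langlands lens-3 gen 36 (planner-decomp-langlands-lens-3-g36-0): the node cut of LEV in the GALOIS language
TARGET (tree decl, BY NAME): LEV = `Summit.Langlands.Langlands.Theorems.BoxCapture.LevelIsolation` — the IDEA-NEEDED cell of CLASS =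
`Summit.Langlands.Langlands.Theses.DepthPrimeSplit.Classicality` (stmt-Langlands-25026, crux r5 of route-Langlands-DepthPrimeSplit; g34 cut
CLASS ⟺ LEV ∧ WT ∧ HC, g35 cut LEV ⟺ TLI ∧ WLR by PLACE in the automorphic language).  LEV: an irreducible pinned-geometric `ρ` that is
pro-automorphic (C: ONE finite `S`, to every depth `r` an L-algebraic cuspidal `π_r` `r`-close to `ρ` off `S`) is pro-automorphic OF BOUNDED
CONDUCTOR (C^lev: the levels of the `π_r` lie in ONE finite set).
THE ONE EQUIV (lens 3), modulo the host cone:  LEV ⟺ GLI := «AVATARED level isolation»  (`levelIsolation_iff_avatared`), modulo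
CRD (stmt-17930) and the AVATAR SUPPLY AVS «C ⟹ C^av», itself PROVED here from the cone binders W⁺ (17415), P (17534), L∤R (18084)
(`avatarSupply_of_cone` — the prime-switch patching of `PrimeSwitchSplit.closes`).  Second language: the approximating family carries its
GALOIS AVATARS — C^av: to every depth `r` an L-algebraic cuspidal `π_r` together with an irreducible pinned-geometric `ρ'_r` CORRESPONDING to
`π_r` for `Rec` at every finite place (`IsCompatibleAvatar`), `π_r` `r`-close to `ρ` off `S`.  In this language the level of `π_r` is read
off the CONDUCTORS `a_v(ρ'_r)` of the avatars (`HasConductorLE`, the tree's `WeilDeligneRep.conductor`, a purely Galois-side datum), and LEV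
becomes a statement about ℓ-adically convergent sequences of geometric Galois representations.
SPLIT BENEATH (refinement, `gli_of_trs_trl`; `trl_of_gli`):  GLI ⟸ TRS ∧ TRL, and EXACTLY (`conductorRigidity_iff_away_above`)
TRS ⟺ TRS∤ ∧ TRS∣ (transitivity ladder C^av → C^{av,c∤} → C^{av,c}):
* TRS∤ `ConductorRigidityAway` — along an avatared family converging to `ρ` off `S`, the conductors of the avatars at the places `v ∈ S`,
  `v ∤ ℓ`, can be taken BOUNDED (uniformly in the depth).  ATTACKABLE-NOW: for depth `< 1` the avatar is congruent to `ρ` modulo `𝔪`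
  (Chebyshev + Brauer–Nesbitt on the density-one set of good places), the wild inertia `P_v` is pro-`p`, `p ≠ ℓ`, so `ρ'_r|_{P_v} ≅ ρ|_{P_v}`
  (Brauer: `ℓ'`-group representations are determined by their reduction) and `sw_v(ρ'_r) = sw_v(ρ)`, whence `a_v(ρ'_r) ≤ n + sw_v(ρ)`
  (Carayol 1986/1989, Livné 1989: `N(ρ̄) ∣ N(ρ)` with equal Swan parts; Serre–Tate).  = g35's TLI in Galois currency WITH THE AVATARS IN THE
  HYPOTHESIS (no «modulo (A)»: the cone's (A)-side is consumed once, by AVS).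
* TRS∣ `ConductorRigidityAbove` — the same at the places `v ∣ ℓ`: THE RESIDUAL.  Its content is LOCAL WILD-TYPE RIGIDITY at `p = ℓ`
  (WTR-bdd): along an ℓ-adically convergent sequence of de Rham representations of `G_{K_v}` the Swan conductors of the inertial
  Weil–Deligne types stay bounded.  PROVED HERE IN WORDS for `n = 1` (memo §3.2, TORSION ISOLATION: a finite-order `g ∈ GL_n(𝓞_ℂℓ)` with
  `|g - 1| < ℓ^{-1/(ℓ-1)}` is `1` (`log`/`exp`), and the algebraic part `∏ σ(u)^{a_σ}` of a de Rham character lies within `|u - 1|` of `1` on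
  units; so two de Rham characters at distance `< ℓ^{-1/(ℓ-1)}` differ by a type of conductor exponent `≤ ⌊e_v/(ℓ-1)⌋ + 1`); UNDECIDED for
  `n ≥ 2` (integral `p`-adic Hodge theory controls types only for FIXED Hodge type / fixed over-field — Kisin 2008, Emerton–Gee 2023
  Thm 1.2.4 / Cor 4.6.5 — while the weights of the `π_r` are unbounded); the alternative attack is family-switching (Katz–Hida level/weight
  exchange, = g35's WLR, IDEA-NEEDED for `l₀ > 0`).  Either proof of TRS∣ closes LEV's open kernel inside the cone.
* TRL `ConductorLevelTransfer` — C^{av,c} ⟹ C^lev: PRINT, Langlands-free dictionary (LGC of the avatar at `v ∈ S` is GIVEN by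
  `Corresponds`; Harris–Taylor/Henniart: `rec_v` preserves conductors; JPSS 1981: conductor = level of the essential vector; off `S` the
  `π_r` are unramified by `CloseAt`; Flath ⊗′ assembles ONE `K(𝔫)`-fixed form, `𝔫 = ∏_{v∈S} 𝔭_v^{c_v}`).
ROOT-IMPLIED (no EXCESS): `pieces_of_langlands : Langlands → AVS ∧ GLI ∧ TRS ∧ TRS∤ ∧ TRS∣ ∧ TRL` (constant family = `ρ`'s own `π` with `ρ` as
its own avatar; the conductor bound is read off the Weil–Deligne representations given by local–global compatibility).
WEAKER: GLI ⟸ LEV and TRL ⟸ GLI in the kernel (`gli_of_lev`, `trl_of_gli`); TRS∤, TRS∣ ⟸ TRS; TRS is root-implied and NOT a formal consequence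
of LEV (the reverse dictionary level ⟹ conductor is print, not kernel) — census twin lands all as helpers.
FRAMES: `closes_levelIsolation : CRD → W⁺ → P → L∤R → TRS → TRL → BoxCapture.LevelIsolation`;
`closes_classicality_av : CRD → W⁺ → P → L∤R → TRS → TRL → WT → HC → DepthPrimeSplit.Classicality`;
`closes_root_av : D → O → F → TRS → TRL → WT → HC → W⁺ → P → L∤R → CRD → Langlands` (= `BoxCapture.closes_root` with LEV discharged; every
binder consumed; the cone binders W⁺ P L∤R CRD were already binders of the root frame, so the EQUIV costs nothing at the root).
Typed-not-filed (Langlands route freeze 2026-08-31; D-0186): census twin verb in RUNME.md (`--supports stmt-Langlands-25026 --as helper`).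
-/
set_option linter.dupNamespace false
namespace Summit.Langlands.Langlands.Theorems.AvatarConductor

open scoped NumberField MatrixGroups
open Filter Field IsDedekindDomain
open Literature.NumberTheory.GaloisRepresentations Literature.NumberTheory.Automorphic
open Summit.Langlands.Langlands.Theorems.TransientLevel
open Summit.Langlands.Langlands.Theorems.BoxCapture (HasLevel IsLevelBoundedProAutomorphic LevelIsolation WeightIsolation HarishChandraCapture)
open Summit.Langlands.Langlands.Theses

/-! ## 1. Vocabulary — the second language: AVATARED families and the CONDUCTORS of the avatars
(C = `IsProAutomorphic`, C^lev = `IsLevelBoundedProAutomorphic`, `CloseAt`, `IsPinnedGeometric`, `Corresponds` are the tree's, BY NAME) -/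

section Vocabulary

variable {K : Type} [Field K] [NumberField K] {n : ℕ} {ℓ : ℕ} [Fact ℓ.Prime]

/-- COMPATIBLE AVATAR · `ρ'` is an (ℓ, ι)-adic Galois avatar of `π` for the reciprocity datum `Rec`: irreducible, pinned-geometric
(a.e. unramified, de Rham above `ℓ` for Fontaine's pinned datum) and CORRESPONDING to `π` (Satake–Frobenius a.e. + local–global
compatibility at EVERY finite place) — exactly what direction (A) of the summit hands out. -/
def IsCompatibleAvatar (Rec : ReciprocityData K) {hcpt : isCompact_glFiniteIntegralLevel n K} (ι : PadicAlgCl ℓ ≃+* ℂ)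
    (π : CuspidalAutomorphicRepData n K hcpt) (ρ' : FramedGaloisRep K (PadicAlgCl ℓ) n) : Prop :=
  ρ'.toGaloisRep.IsIrreducible ∧ IsPinnedGeometric ρ' ∧ Corresponds Rec ι π.1 ρ'

/-- CONDUCTOR DATUM (Galois side only) · `ρ'` HAS CONDUCTOR `≤ c` AT `v`: some Weil–Deligne representation `r` of `W_{K_v}` which IS
`WD(ρ'|_{Γ_{K_v}})` — Grothendieck–Deligne if `v ∤ ℓ`, Fontaine's pinned `D_pst` if `v ∣ ℓ`, the two clauses of `LocalGlobalCompatibleAt`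
verbatim — has `conductor r ≤ c` (tree `WeilDeligneRep.conductor`: Artin conductor of the Weil representation + monodromy drop). -/
def HasConductorLE (ρ' : FramedGaloisRep K (PadicAlgCl ℓ) n) (v : HeightOneSpectrum (𝓞 K)) (c : ℕ) : Prop :=
  ∃ r : WeilDeligneRep (v.adicCompletion K) (PadicAlgCl ℓ) (Fin n → PadicAlgCl ℓ),
    (((ℓ : ℕ) : 𝓞 K) ∉ v.asIdeal → IsWeilDeligneOfLadic (ρ'.toLocal v).toWeilGroupHom r) ∧
    (∀ hv : ((ℓ : ℕ) : 𝓞 K) ∈ v.asIdeal,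
      (Literature.NumberTheory.PAdicHodge.fontainePstAdicCompletion v ℓ hv).IsWeilDeligneOf (ρ'.toLocal v) r) ∧
    r.conductor ≤ c

/-- C^av · AVATARED PRO-AUTOMORPHIC: ONE finite `S` such that to every depth `r > 0` some L-algebraic cuspidal `π_r` WITH A COMPATIBLE
AVATAR `ρ'_r` (for `Rec`, same `ℓ`, `ι`) is `r`-close to `ρ` at every `v ∉ S`. -/
def IsAvataredProAutomorphic (Rec : ReciprocityData K) (hcpt : isCompact_glFiniteIntegralLevel n K) (ι : PadicAlgCl ℓ ≃+* ℂ)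
    (ρ : FramedGaloisRep K (PadicAlgCl ℓ) n) : Prop :=
  ∃ S : Set (HeightOneSpectrum (𝓞 K)), S.Finite ∧ ∀ r : NNReal, 0 < r →
    ∃ π : CuspidalAutomorphicRepData n K hcpt, π.1.IsLAlgebraic ∧
      (∃ ρ' : FramedGaloisRep K (PadicAlgCl ℓ) n, IsCompatibleAvatar Rec ι π ρ') ∧
      ∀ v : HeightOneSpectrum (𝓞 K), v ∉ S → CloseAt ι π ρ r v

/-- C^{av,c∤} · AVATARED OF BOUNDED CONDUCTOR AWAY FROM `ℓ`: as C^av, and ONE bound `c : v ↦ c_v` (independent of the depth) such that the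
avatar of every approximant has conductor `≤ c_v` at every `v ∈ S` NOT above `ℓ`. -/
def IsConductorBoundedAwayProAutomorphic (Rec : ReciprocityData K) (hcpt : isCompact_glFiniteIntegralLevel n K) (ι : PadicAlgCl ℓ ≃+* ℂ)
    (ρ : FramedGaloisRep K (PadicAlgCl ℓ) n) : Prop :=
  ∃ S : Set (HeightOneSpectrum (𝓞 K)), S.Finite ∧ ∃ c : HeightOneSpectrum (𝓞 K) → ℕ, ∀ r : NNReal, 0 < r →
    ∃ π : CuspidalAutomorphicRepData n K hcpt, π.1.IsLAlgebraic ∧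
      (∃ ρ' : FramedGaloisRep K (PadicAlgCl ℓ) n, IsCompatibleAvatar Rec ι π ρ' ∧
        ∀ v ∈ S, ((ℓ : ℕ) : 𝓞 K) ∉ v.asIdeal → HasConductorLE ρ' v (c v)) ∧
      ∀ v : HeightOneSpectrum (𝓞 K), v ∉ S → CloseAt ι π ρ r v

/-- C^{av,c} · AVATARED OF BOUNDED CONDUCTOR: as C^av, and ONE bound `c : v ↦ c_v` (independent of the depth) such that the avatar of every
approximant has conductor `≤ c_v` at EVERY `v ∈ S` (off `S` the approximants are unramified: `CloseAt` carries a Satake datum). -/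
def IsConductorBoundedProAutomorphic (Rec : ReciprocityData K) (hcpt : isCompact_glFiniteIntegralLevel n K) (ι : PadicAlgCl ℓ ≃+* ℂ)
    (ρ : FramedGaloisRep K (PadicAlgCl ℓ) n) : Prop :=
  ∃ S : Set (HeightOneSpectrum (𝓞 K)), S.Finite ∧ ∃ c : HeightOneSpectrum (𝓞 K) → ℕ, ∀ r : NNReal, 0 < r →
    ∃ π : CuspidalAutomorphicRepData n K hcpt, π.1.IsLAlgebraic ∧
      (∃ ρ' : FramedGaloisRep K (PadicAlgCl ℓ) n, IsCompatibleAvatar Rec ι π ρ' ∧ ∀ v ∈ S, HasConductorLE ρ' v (c v)) ∧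
      ∀ v : HeightOneSpectrum (𝓞 K), v ∉ S → CloseAt ι π ρ r v

end Vocabulary

/-! ## 2. The items (Frame = LEV's binders and standing hypotheses VERBATIM with `(Rec : ReciprocityData K)` inserted after `K` exactly as in
L∤R stmt-18084; only the pro-automorphy hypothesis / conclusion change) -/

/-- AVS · AVATAR SUPPLY · glue · DOMINATED by the host cone (PROVED from W⁺ ∧ P ∧ L∤R: `avatarSupply_of_cone`) · root-implied.  C ⟹ C^av: every
L-algebraic approximant has a compatible (ℓ, ι)-adic avatar for every `Rec`.  The «modulo» of the EQUIV; never staffed. -/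
def AvatarSupply : Prop :=
  ∀ (K : Type) [Field K] [NumberField K] (Rec : ReciprocityData K) (n : ℕ) (hcpt : isCompact_glFiniteIntegralLevel n K), 0 < n →
    ∀ (ℓ : ℕ) [Fact ℓ.Prime] (ι : PadicAlgCl ℓ ≃+* ℂ) (ρ : FramedGaloisRep K (PadicAlgCl ℓ) n),
      ρ.toGaloisRep.IsIrreducible → IsPinnedGeometric ρ → IsProAutomorphic hcpt ι ρ → IsAvataredProAutomorphic Rec hcpt ι ρ

/-- GLI · AVATARED LEVEL ISOLATION · the EQUIV partner of LEV (LEV ⟺ GLI modulo CRD ∧ AVS, `levelIsolation_iff_avatared`) · WEAKER (⟸ LEV,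
`gli_of_lev`) · root-implied · refined beneath into TRS ∧ TRL.  An avatared pro-automorphic `ρ` is pro-automorphic of bounded conductor. -/
def AvataredLevelIsolation : Prop :=
  ∀ (K : Type) [Field K] [NumberField K] (Rec : ReciprocityData K) (n : ℕ) (hcpt : isCompact_glFiniteIntegralLevel n K), 0 < n →
    ∀ (ℓ : ℕ) [Fact ℓ.Prime] (ι : PadicAlgCl ℓ ≃+* ℂ) (ρ : FramedGaloisRep K (PadicAlgCl ℓ) n),
      ρ.toGaloisRep.IsIrreducible → IsPinnedGeometric ρ → IsAvataredProAutomorphic Rec hcpt ι ρ → IsLevelBoundedProAutomorphic hcpt ι ρ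

/-- TRS · CONDUCTOR RIGIDITY · crux rank 2 · root-implied · = TRS∤ ∧ TRS∣ exactly (`conductorRigidity_iff_away_above`).  Along an avatared family
converging to `ρ` off `S` the conductors of the avatars at the places of `S` can be taken bounded uniformly in the depth.  Why it might fail:
at `v ∣ ℓ` the weights of the `π_r` are unbounded and no integral `p`-adic Hodge theory bounds the wild type of a limit of representations of
unbounded Hodge type (TRS∣); at `v ∤ ℓ` it does not fail (TRS∤).  Sources: Carayol 1986, Livné 1989, Kisin 2008, EmertonGee2023 (Cor. 4.6.5). -/
def ConductorRigidity : Prop :=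
  ∀ (K : Type) [Field K] [NumberField K] (Rec : ReciprocityData K) (n : ℕ) (hcpt : isCompact_glFiniteIntegralLevel n K), 0 < n →
    ∀ (ℓ : ℕ) [Fact ℓ.Prime] (ι : PadicAlgCl ℓ ≃+* ℂ) (ρ : FramedGaloisRep K (PadicAlgCl ℓ) n),
      ρ.toGaloisRep.IsIrreducible → IsPinnedGeometric ρ → IsAvataredProAutomorphic Rec hcpt ι ρ → IsConductorBoundedProAutomorphic Rec hcpt ι ρ

/-- TRS∤ · CONDUCTOR RIGIDITY AWAY FROM `ℓ` · crux rank 4 · WEAKER (⟸ TRS) · root-implied · ATTACKABLE-NOW (Swan rigidity at `v ∤ ℓ`: a mod-`𝔪`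
congruence of semisimplified representations fixes the restriction to the pro-`p` wild inertia, `p ≠ ℓ`, hence the Swan conductor, so
`a_v(ρ'_r) ≤ n + sw_v(ρ)` for depth `< 1`).  Why it might fail: only the in-tree API (Chebotarev for trace congruences, Brauer–Nesbitt, the
upper-numbering Swan integral of `WeilDeligneRep.conductor`) — mathematically textbook.  Sources: Carayol 1986, Livné 1989 (cornell1997 p.428),
Serre–Tate 1968, Katz 1988 (1.6–1.10). -/
def ConductorRigidityAway : Prop :=
  ∀ (K : Type) [Field K] [NumberField K] (Rec : ReciprocityData K) (n : ℕ) (hcpt : isCompact_glFiniteIntegralLevel n K), 0 < n →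
    ∀ (ℓ : ℕ) [Fact ℓ.Prime] (ι : PadicAlgCl ℓ ≃+* ℂ) (ρ : FramedGaloisRep K (PadicAlgCl ℓ) n),
      ρ.toGaloisRep.IsIrreducible → IsPinnedGeometric ρ → IsAvataredProAutomorphic Rec hcpt ι ρ →
        IsConductorBoundedAwayProAutomorphic Rec hcpt ι ρ

/-- TRS∣ · CONDUCTOR RIGIDITY ABOVE `ℓ` · crux rank 3 · THE RESIDUAL of LEV inside the cone · WEAKER (⟸ TRS) · root-implied · n = 1 PROVABLE
(memo §3.2) · UNDECIDED for n ≥ 2.  An avatared family of bounded conductor away from `ℓ` can be improved (sub-family or another family) to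
one of bounded conductor at the places above `ℓ` too.  Two attacks: (i) WILD-TYPE RIGIDITY WTR-bdd — along an ℓ-adically convergent sequence
of de Rham representations of `G_{K_v}`, `v ∣ ℓ`, the Swan conductors of the inertial types are bounded (then the SAME family works; true for
characters and for families triangulable by characters congruent to `ρ`'s — torsion isolation `|ζ_ℓ - 1| = ℓ^{-1/(ℓ-1)}`, memo §3.2; open for
irreducible local pieces of rank ≥ 2 with unbounded Hodge type); (ii) FAMILY SWITCHING — Katz–Hida level/weight exchange (GL₂/ℚ, Hida 1988 over totally
real fields; IDEA-NEEDED for `l₀ > 0`).  Why it might fail: (i) may be false in rank ≥ 2 (potentially crystalline points of growing wild type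
and growing weight accumulating at a de Rham point is not excluded by any theorem we found) and (ii) has no analogue off Shimura/`q`-expansion
settings.  Sources: Kisin 2008 (pst deformation rings), EmertonGee2023 Thm 1.2.4/Rem 1.2.5/Cor 4.6.5, Coleman–Stein 2004
(doi:10.1515/9783110198133.1.437), Calegari arXiv:math/0702434 p.2, Katz 1975, Hida 1988; BARRIER ShimuraVarietyRealization (attack ii only). -/
def ConductorRigidityAbove : Prop :=
  ∀ (K : Type) [Field K] [NumberField K] (Rec : ReciprocityData K) (n : ℕ) (hcpt : isCompact_glFiniteIntegralLevel n K), 0 < n →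
    ∀ (ℓ : ℕ) [Fact ℓ.Prime] (ι : PadicAlgCl ℓ ≃+* ℂ) (ρ : FramedGaloisRep K (PadicAlgCl ℓ) n),
      ρ.toGaloisRep.IsIrreducible → IsPinnedGeometric ρ → IsConductorBoundedAwayProAutomorphic Rec hcpt ι ρ →
        IsConductorBoundedProAutomorphic Rec hcpt ι ρ

/-- TRL · CONDUCTOR–LEVEL TRANSFER · support rank 9 · PRINT (Langlands-free dictionary) · WEAKER (⟸ GLI ⟸ LEV, `trl_of_gli`) · root-implied.
An avatared family of bounded conductor is a family of bounded level: at `v ∈ S` local–global compatibility of the avatar (GIVEN by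
`Corresponds`) transports `a_v(ρ'_r) ≤ c_v` to `a(π_{r,v}) ≤ c_v` (Harris–Taylor/Henniart: `rec_v` preserves conductors = ε-exponents), JPSS
1981 gives a `K_1(𝔭_v^{c_v})`-fixed essential vector, off `S` the `π_r` are unramified (`CloseAt` ⊃ Satake datum), and Flath's ⊗′ yields ONE
`K(𝔫)`-fixed form `φ ∈ W ∖ W'`, `𝔫 = ∏_{v∈S} 𝔭_v^{c_v}` (`HasLevel`).  Why it might fail: only the tree's automorphic API (local components ↔
global fixed vectors).  Sources: JPSS 1981 (Math. Ann. 256; cornell1997 p.261), Flath 1979, HarrisTaylorAMS2001 Thm A, Henniart2000. -/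
def ConductorLevelTransfer : Prop :=
  ∀ (K : Type) [Field K] [NumberField K] (Rec : ReciprocityData K) (n : ℕ) (hcpt : isCompact_glFiniteIntegralLevel n K), 0 < n →
    ∀ (ℓ : ℕ) [Fact ℓ.Prime] (ι : PadicAlgCl ℓ ≃+* ℂ) (ρ : FramedGaloisRep K (PadicAlgCl ℓ) n),
      ρ.toGaloisRep.IsIrreducible → IsPinnedGeometric ρ → IsConductorBoundedProAutomorphic Rec hcpt ι ρ → IsLevelBoundedProAutomorphic hcpt ι ρ

/-- The optional ASSEMBLY item of the child on GLI: TRS → TRL → GLI (proved: `avatarConductorAssembly_proof`; the bare name `Assembly` is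
registry-owned). -/
def AvatarConductorAssembly : Prop :=
  ConductorRigidity → ConductorLevelTransfer → AvataredLevelIsolation

/-! ## 3. Kernel — the forgetful ladder C^{av,c} ⟹ C^{av,c∤} ⟹ C^av ⟹ C and the avatar supply from the cone -/

section Kernel

variable {K : Type} [Field K] [NumberField K] {n : ℕ} {ℓ : ℕ} [Fact ℓ.Prime] {Rec : ReciprocityData K}
  {hcpt : isCompact_glFiniteIntegralLevel n K} {ι : PadicAlgCl ℓ ≃+* ℂ} {ρ : FramedGaloisRep K (PadicAlgCl ℓ) n}

/-- DOWN: bounded conductor ⟹ bounded conductor away from `ℓ` (forget the bound above `ℓ`). -/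
theorem away_of_conductorBounded (h : IsConductorBoundedProAutomorphic Rec hcpt ι ρ) :
    IsConductorBoundedAwayProAutomorphic Rec hcpt ι ρ := by
  obtain ⟨S, hS, c, h⟩ := h
  refine ⟨S, hS, c, fun r hr => ?_⟩
  obtain ⟨π, hπ, ⟨ρ', hav, hc⟩, hclose⟩ := h r hr
  exact ⟨π, hπ, ⟨ρ', hav, fun v hv _ => hc v hv⟩, hclose⟩

/-- DOWN: bounded conductor away from `ℓ` ⟹ avatared (forget the bound). -/
theorem avatared_of_away (h : IsConductorBoundedAwayProAutomorphic Rec hcpt ι ρ) : IsAvataredProAutomorphic Rec hcpt ι ρ := by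
  obtain ⟨S, hS, _c, h⟩ := h
  refine ⟨S, hS, fun r hr => ?_⟩
  obtain ⟨π, hπ, ⟨ρ', hav, _hc⟩, hclose⟩ := h r hr
  exact ⟨π, hπ, ⟨ρ', hav⟩, hclose⟩

/-- DOWN: bounded conductor ⟹ avatared. -/
theorem avatared_of_conductorBounded (h : IsConductorBoundedProAutomorphic Rec hcpt ι ρ) : IsAvataredProAutomorphic Rec hcpt ι ρ :=
  avatared_of_away (away_of_conductorBounded h)

/-- DOWN: avatared ⟹ C (forget the avatars; the target's hypothesis). -/
theorem pro_of_avatared (h : IsAvataredProAutomorphic Rec hcpt ι ρ) : IsProAutomorphic hcpt ι ρ := by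
  obtain ⟨S, hS, h⟩ := h
  refine ⟨S, hS, fun r hr => ?_⟩
  obtain ⟨π, hπ, _hav, hclose⟩ := h r hr
  exact ⟨π, hπ, hclose⟩

/-- **THE AVATAR SUPPLY FROM THE CONE (one approximant):** under W⁺ ∧ P ∧ L∤R every L-algebraic cuspidal `π` has a compatible (ℓ, ι)-adic
avatar for every `Rec` — W⁺ gives an irreducible a.e.-compatible `ρ'`, P(i) makes it de Rham above `ℓ`, L∤R gives local–global compatibility
at `v ∤ ℓ`, and at `v ∣ ℓ` the prime switch: compatibility of an `ℓ'`-adic avatar (`ℓ' ∈ {2, 3}`, `v ∤ ℓ'`) moved to `ρ'` by P(ii). -/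
theorem exists_compatibleAvatar_of_cone (hW : DepthPrimeSplit.SatakeAvatarExistence) (hP : DepthPrimeSplit.PadicMemberCompatibility)
    (hA : DepthPrimeSplit.CompatibilityAwayFromLR) (Rec : ReciprocityData K) (hn : 0 < n) (π : CuspidalAutomorphicRepData n K hcpt)
    (hπ : π.1.IsLAlgebraic) (ι : PadicAlgCl ℓ ≃+* ℂ) : ∃ ρ' : FramedGaloisRep K (PadicAlgCl ℓ) n, IsCompatibleAvatar Rec ι π ρ' := by
  obtain ⟨ρ', hirr, hρ'⟩ := hW K n hcpt hn π hπ ℓ ι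
  have hgeo : IsPinnedGeometric ρ' :=
    ⟨hρ'.mono fun v ⟨_, _, hur, _⟩ => hur, fun v hv => (hP K n hcpt hn π hπ ℓ ι ρ' hirr hρ' v hv).1⟩
  refine ⟨ρ', hirr, hgeo, hρ', fun v => ?_⟩
  by_cases hv : ((ℓ : ℕ) : 𝓞 K) ∈ v.asIdeal
  · -- every finite place misses the prime `2` or the prime `3` (the prime switch of `PrimeSwitchSplit.closes`;
    -- in the tree as `ReciprocityUpToIrreducibility.exists_prime_natCast_not_mem`, whose module is not importable here)
    obtain ⟨ℓ', _, hℓ'⟩ : ∃ (ℓ' : ℕ) (_ : Fact ℓ'.Prime), ((ℓ' : ℕ) : 𝓞 K) ∉ v.asIdeal := by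
      by_cases h2 : ((2 : ℕ) : 𝓞 K) ∈ v.asIdeal
      · refine ⟨3, ⟨Nat.prime_three⟩, fun h3 => v.isPrime.ne_top ((Ideal.eq_top_iff_one _).2 ?_)⟩
        have h := v.asIdeal.sub_mem h3 h2
        have h1 : ((3 : ℕ) : 𝓞 K) - ((2 : ℕ) : 𝓞 K) = 1 := by push_cast; norm_num
        rwa [h1] at h
      · exact ⟨2, ⟨Nat.prime_two⟩, h2⟩
    obtain ⟨ι'⟩ := PadicAlgCl.nonempty_ringEquiv_complex ℓ'
    obtain ⟨ρ'', hirr'', hρ''⟩ := hW K n hcpt hn π hπ ℓ' ι'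
    have hgeo'' : IsPinnedGeometric ρ'' :=
      ⟨hρ''.mono fun w ⟨_, _, hur, _⟩ => hur, fun w hw => (hP K n hcpt hn π hπ ℓ' ι' ρ'' hirr'' hρ'' w hw).1⟩
    exact (hP K n hcpt hn π hπ ℓ ι ρ' hirr hρ' v hv).2 Rec ℓ' ι' ρ'' hℓ' hirr'' hρ''
      (hA K Rec n hcpt hn π hπ ℓ' ι' ρ'' hirr'' hgeo'' hρ'' v hℓ')
  · exact hA K Rec n hcpt hn π hπ ℓ ι ρ' hirr hgeo hρ' v hv

/-- UP, from the cone: C ⟹ C^av (attach the avatars to the given family). -/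
theorem avatared_of_pro_of_cone (hW : DepthPrimeSplit.SatakeAvatarExistence) (hP : DepthPrimeSplit.PadicMemberCompatibility)
    (hA : DepthPrimeSplit.CompatibilityAwayFromLR) (Rec : ReciprocityData K) (hn : 0 < n) (h : IsProAutomorphic hcpt ι ρ) :
    IsAvataredProAutomorphic Rec hcpt ι ρ := by
  obtain ⟨S, hS, h⟩ := h
  refine ⟨S, hS, fun r hr => ?_⟩
  obtain ⟨π, hπ, hclose⟩ := h r hr
  exact ⟨π, hπ, exists_compatibleAvatar_of_cone hW hP hA Rec hn π hπ ι, hclose⟩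

end Kernel

/-! ## 4. THE EQUIV (modulo CRD ∧ AVS, AVS ⟸ cone) and the split beneath -/

/-- LEV ⟹ GLI (modulo nothing: forget the avatars). -/
theorem gli_of_lev (h : LevelIsolation) : AvataredLevelIsolation :=
  fun K _ _ _Rec n hcpt hn ℓ _ ι ρ hirr hgeo hav => h K n hcpt hn ℓ ι ρ hirr hgeo (pro_of_avatared hav)

/-- GLI ⟹ LEV modulo CRD (a reciprocity datum to read the avatars in) and AVS (the avatars of the approximants). -/
theorem lev_of_gli (hR : DepthPrimeSplit.CanonicalReciprocityData) (hV : AvatarSupply) (h : AvataredLevelIsolation) : LevelIsolation :=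
  fun K _ _ n hcpt hn ℓ _ ι ρ hirr hgeo hC => by
    obtain ⟨Rec⟩ := hR K
    exact h K Rec n hcpt hn ℓ ι ρ hirr hgeo (hV K Rec n hcpt hn ℓ ι ρ hirr hgeo hC)

/-- **THE ONE EQUIV: LEV ⟺ GLI modulo CRD ∧ AVS.** -/
theorem levelIsolation_iff_avatared (hR : DepthPrimeSplit.CanonicalReciprocityData) (hV : AvatarSupply) :
    LevelIsolation ↔ AvataredLevelIsolation :=
  ⟨gli_of_lev, lev_of_gli hR hV⟩

/-- **AVS ⟸ the cone's (A)-side binders W⁺ ∧ P ∧ L∤R** (so the EQUIV is modulo the host cone only). -/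
theorem avatarSupply_of_cone (hW : DepthPrimeSplit.SatakeAvatarExistence) (hP : DepthPrimeSplit.PadicMemberCompatibility)
    (hA : DepthPrimeSplit.CompatibilityAwayFromLR) : AvatarSupply :=
  fun _K _ _ Rec _n _hcpt hn _ℓ _ _ι _ρ _hirr _hgeo hC => avatared_of_pro_of_cone hW hP hA Rec hn hC

/-- the EQUIV read modulo the host cone binders. -/
theorem levelIsolation_iff_avatared_of_cone (hR : DepthPrimeSplit.CanonicalReciprocityData) (hW : DepthPrimeSplit.SatakeAvatarExistence)
    (hP : DepthPrimeSplit.PadicMemberCompatibility) (hA : DepthPrimeSplit.CompatibilityAwayFromLR) :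
    LevelIsolation ↔ AvataredLevelIsolation :=
  levelIsolation_iff_avatared hR (avatarSupply_of_cone hW hP hA)

/-- SPLIT BENEATH: TRS ∧ TRL ⟹ GLI (composition through C^{av,c}). -/
theorem gli_of_trs_trl (h₁ : ConductorRigidity) (h₂ : ConductorLevelTransfer) : AvataredLevelIsolation :=
  fun K _ _ Rec n hcpt hn ℓ _ ι ρ hirr hgeo hav => h₂ K Rec n hcpt hn ℓ ι ρ hirr hgeo (h₁ K Rec n hcpt hn ℓ ι ρ hirr hgeo hav)

/-- the assembly item, proved. -/
theorem avatarConductorAssembly_proof : AvatarConductorAssembly := gli_of_trs_trl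

/-- GLI ⟹ TRL (forget the conductor bound): TRL is WEAKER than GLI, hence than LEV. -/
theorem trl_of_gli (h : AvataredLevelIsolation) : ConductorLevelTransfer :=
  fun K _ _ Rec n hcpt hn ℓ _ ι ρ hirr hgeo hcb => h K Rec n hcpt hn ℓ ι ρ hirr hgeo (avatared_of_conductorBounded hcb)

/-- TRL ⟸ LEV. -/
theorem trl_of_lev (h : LevelIsolation) : ConductorLevelTransfer :=
  trl_of_gli (gli_of_lev h)

/-- TRS ⟹ TRS∤. -/
theorem away_of_trs (h : ConductorRigidity) : ConductorRigidityAway :=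
  fun K _ _ Rec n hcpt hn ℓ _ ι ρ hirr hgeo hav => away_of_conductorBounded (h K Rec n hcpt hn ℓ ι ρ hirr hgeo hav)

/-- TRS ⟹ TRS∣. -/
theorem above_of_trs (h : ConductorRigidity) : ConductorRigidityAbove :=
  fun K _ _ Rec n hcpt hn ℓ _ ι ρ hirr hgeo haw => h K Rec n hcpt hn ℓ ι ρ hirr hgeo (avatared_of_away haw)

/-- TRS∤ ∧ TRS∣ ⟹ TRS (composition). -/
theorem trs_of_away_above (h₁ : ConductorRigidityAway) (h₂ : ConductorRigidityAbove) : ConductorRigidity :=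
  fun K _ _ Rec n hcpt hn ℓ _ ι ρ hirr hgeo hav => h₂ K Rec n hcpt hn ℓ ι ρ hirr hgeo (h₁ K Rec n hcpt hn ℓ ι ρ hirr hgeo hav)

/-- **EXACT (modulo nothing): TRS ⟺ TRS∤ ∧ TRS∣** — conductor rigidity is rigidity away from `ℓ` followed by rigidity above `ℓ`. -/
theorem conductorRigidity_iff_away_above : ConductorRigidity ↔ ConductorRigidityAway ∧ ConductorRigidityAbove :=
  ⟨fun h => ⟨away_of_trs h, above_of_trs h⟩, fun h => trs_of_away_above h.1 h.2⟩

/-- the three-piece form of the split: TRS∤ → TRS∣ → TRL → GLI. -/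
theorem gli_of_three (h₁ : ConductorRigidityAway) (h₂ : ConductorRigidityAbove) (h₃ : ConductorLevelTransfer) : AvataredLevelIsolation :=
  gli_of_trs_trl (trs_of_away_above h₁ h₂) h₃

/-! ## 5. ROOT-IMPLIED certificate (no EXCESS): the summit implies every new piece -/

section Root

variable {K : Type} [Field K] [NumberField K] {n : ℕ} {ℓ : ℕ} [Fact ℓ.Prime]

/-- Under `Langlands`, every irreducible pinned-geometric `ρ` is avatared of bounded conductor by the CONSTANT family: direction (B) gives its
`π`, `ρ` is its own compatible avatar, and the bound `c_v` is the conductor of the Weil–Deligne representation that local–global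
compatibility at `v` provides. -/
theorem conductorBounded_of_langlands (hL : _root_.Langlands) (Rec : ReciprocityData K) (hcpt : isCompact_glFiniteIntegralLevel n K)
    (hn : 0 < n) (ι : PadicAlgCl ℓ ≃+* ℂ) (ρ : FramedGaloisRep K (PadicAlgCl ℓ) n) (hirr : ρ.toGaloisRep.IsIrreducible)
    (hgeo : IsPinnedGeometric ρ) : IsConductorBoundedProAutomorphic Rec hcpt ι ρ := by
  obtain ⟨_, h⟩ := hL K
  obtain ⟨π, hπ, hcorr⟩ := (h Rec n hn hcpt).2 ℓ ι ρ hirr ⟨hgeo.1, fun v hv => hgeo.2 v hv⟩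
  have hwd : ∀ v : HeightOneSpectrum (𝓞 K), ∃ r : WeilDeligneRep (v.adicCompletion K) (PadicAlgCl ℓ) (Fin n → PadicAlgCl ℓ),
      (((ℓ : ℕ) : 𝓞 K) ∉ v.asIdeal → IsWeilDeligneOfLadic (ρ.toLocal v).toWeilGroupHom r) ∧
      (∀ hv : ((ℓ : ℕ) : 𝓞 K) ∈ v.asIdeal,
        (Literature.NumberTheory.PAdicHodge.fontainePstAdicCompletion v ℓ hv).IsWeilDeligneOf (ρ.toLocal v) r) := fun v => by
    obtain ⟨_πv, r, _rℂ, _, h₂, h₃, _, _⟩ := hcorr.2 v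
    exact ⟨r, h₂, fun hv => h₃ hv⟩
  choose wd hwd using hwd
  refine ⟨{v | ¬ SatakeFrobCompatibleAt ι π.1 ρ v}, Filter.eventually_cofinite.mp hcorr.1, fun v => (wd v).conductor, fun r hr => ?_⟩
  refine ⟨π, hπ, ⟨ρ, ⟨hirr, hgeo, hcorr⟩, fun v _ => ⟨wd v, (hwd v).1, (hwd v).2, le_rfl⟩⟩, fun v hv => closeAt_of_compatible ?_ hr⟩
  by_contra hc
  exact hv hc

end Root

/-- `Langlands ⟹ TRS`. -/
theorem trs_of_langlands (hL : _root_.Langlands) : ConductorRigidity :=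
  fun _K _ _ Rec _n hcpt hn _ℓ _ ι ρ hirr hgeo _hav => conductorBounded_of_langlands hL Rec hcpt hn ι ρ hirr hgeo

/-- `Langlands ⟹ AVS`. -/
theorem avs_of_langlands (hL : _root_.Langlands) : AvatarSupply :=
  fun _K _ _ Rec _n hcpt hn _ℓ _ ι ρ hirr hgeo _hC => avatared_of_conductorBounded (conductorBounded_of_langlands hL Rec hcpt hn ι ρ hirr hgeo)

/-- `Langlands ⟹ GLI` (through g34's `cells_of_langlands`: LEV holds, and GLI ⟸ LEV). -/
theorem gli_of_langlands (hL : _root_.Langlands) : AvataredLevelIsolation :=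
  gli_of_lev (BoxCapture.cells_of_langlands hL).1

/-- **`Langlands ⟹ AVS ∧ GLI ∧ TRS ∧ TRS∤ ∧ TRS∣ ∧ TRL`** — every piece of the node is a consequence of the summit. -/
theorem pieces_of_langlands (hL : _root_.Langlands) :
    AvatarSupply ∧ AvataredLevelIsolation ∧ ConductorRigidity ∧ ConductorRigidityAway ∧ ConductorRigidityAbove ∧ ConductorLevelTransfer :=
  ⟨avs_of_langlands hL, gli_of_langlands hL, trs_of_langlands hL, away_of_trs (trs_of_langlands hL), above_of_trs (trs_of_langlands hL),
    trl_of_gli (gli_of_langlands hL)⟩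

/-! ## 6. The frames BY NAME -/

/-- **closes (child on LEV = `BoxCapture.LevelIsolation`):** CRD → W⁺ → P → L∤R → TRS → TRL → LEV. -/
theorem closes_levelIsolation (hR : DepthPrimeSplit.CanonicalReciprocityData) (hW : DepthPrimeSplit.SatakeAvatarExistence)
    (hP : DepthPrimeSplit.PadicMemberCompatibility) (hA : DepthPrimeSplit.CompatibilityAwayFromLR) (h₁ : ConductorRigidity)
    (h₂ : ConductorLevelTransfer) : LevelIsolation :=
  lev_of_gli hR (avatarSupply_of_cone hW hP hA) (gli_of_trs_trl h₁ h₂)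

/-- the three-piece frame on LEV: CRD → W⁺ → P → L∤R → TRS∤ → TRS∣ → TRL → LEV. -/
theorem closes_levelIsolation₃ (hR : DepthPrimeSplit.CanonicalReciprocityData) (hW : DepthPrimeSplit.SatakeAvatarExistence)
    (hP : DepthPrimeSplit.PadicMemberCompatibility) (hA : DepthPrimeSplit.CompatibilityAwayFromLR) (h₁ : ConductorRigidityAway)
    (h₂ : ConductorRigidityAbove) (h₃ : ConductorLevelTransfer) : LevelIsolation :=
  closes_levelIsolation hR hW hP hA (trs_of_away_above h₁ h₂) h₃

/-- **closes (child on CLASS stmt-Langlands-25026):** CRD → W⁺ → P → L∤R → TRS → TRL → WT → HC → `DepthPrimeSplit.Classicality`. -/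
theorem closes_classicality_av (hR : DepthPrimeSplit.CanonicalReciprocityData) (hW : DepthPrimeSplit.SatakeAvatarExistence)
    (hP : DepthPrimeSplit.PadicMemberCompatibility) (hA : DepthPrimeSplit.CompatibilityAwayFromLR) (h₁ : ConductorRigidity)
    (h₂ : ConductorLevelTransfer) (h₃ : WeightIsolation) (h₄ : HarishChandraCapture) : DepthPrimeSplit.Classicality :=
  BoxCapture.closes_classicality (closes_levelIsolation hR hW hP hA h₁ h₂) h₃ h₄

/-- **closes_root:** the host route's deciding theorem (`BoxCapture.closes_root` = `DepthPrimeSplit.closes` with CLASS cut) with LEV replaced by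
TRS, TRL — the cone binders W⁺, P, L∤R, CRD it reads the EQUIV in were already binders of the root frame. -/
theorem closes_root_av (hD : DepthPrimeSplit.DyadicSeed) (hO : DepthPrimeSplit.OddPrimeSeed) (hF : DepthPrimeSplit.FernSpread)
    (h₁ : ConductorRigidity) (h₂ : ConductorLevelTransfer) (h₃ : WeightIsolation) (h₄ : HarishChandraCapture)
    (hW : DepthPrimeSplit.SatakeAvatarExistence) (hP : DepthPrimeSplit.PadicMemberCompatibility) (hA : DepthPrimeSplit.CompatibilityAwayFromLR)
    (hR : DepthPrimeSplit.CanonicalReciprocityData) : _root_.Langlands :=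
  BoxCapture.closes_root hD hO hF (closes_levelIsolation hR hW hP hA h₁ h₂) h₃ h₄ hW hP hA hR

end Summit.Langlands.Langlands.Theorems.AvatarConductor
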